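import Summits.Schanuel.Schanuel.Theorems.RootDecomp1KGapCell05

/-!
# RootDecomp1KGapCell — lens 1, generation 42 «GAP CELL / INTERLACED SPECIALISATION» (lane K-R26 (α-loc)): the walls (1, ℓ_b, ρ), (1, ℓ₂, ℓ₃, ρ) (mod hNW), their π-twins and the 31077 pair (ℓ_b, ρ) HYPOTHESIS-FREE for every ρ ∈ `FactorialGapLiouville` — located order data strictly below the log-log floor; member ρ_W — continuation (RootDecomp1KGapCell06): §6 the members zG2/zG3/zG4 and π-twins: LI, LinLiouville, scope certificates

(lens-1 g42 `GapCell.lean` EDITION 3 [HOME/decomp-schanuel-lens-1/g42/ sha256 6f7828b1…, 2470 l; VERDICT L2004, EDITIONS 2+3 L2018, ACK L2023]; port by census-1 gen 17 as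
`RootDecomp1KGapCell01`–`10` — see the PORT NOTE of part 01; `--supports stmt-Schanuel-33364` (04: `stmt-Schanuel-31077`); rung 0.)
-/

open Summit.Schanuel.Schanuel.Theorems.RootDecomp1KHyper
open Summit.Schanuel.Schanuel.Theorems.RootDecomp1KHyper.HyperCell
open Summit.Schanuel.Schanuel.Theorems.RootDecomp1KRelLiouvilleCell
open Summit.Schanuel.Schanuel.Theorems.RootDecomp1KLogLogCell
open Summit.Schanuel.Schanuel.Theorems.RootDecomp1KTwoBaseCell
open LiouvilleNumber
open scoped Nat

namespace Summit.Schanuel.Schanuel.Theorems.RootDecomp1KGapCell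

variable {k n : ℕ}

/-! ## §6  THE MEMBERS `z_G = (1, ℓ₂, ℓ₃, ρ_W)`, `z_G' = (1, ℓ₂, ρ_W)`, `z_G'' = (ℓ₂, ρ_W)` and their π-twins:
scope certificates (hypothesis-free) and the live items APPLIED -/

section Certificates
open IntermediateField

/-- `(1, u⃗)` is ℚ-linearly independent when `u⃗` is algebraically independent over `ℚ`. -/
private theorem linearIndependent_one_cons_of_algebraicIndependent {m : ℕ} {u : Fin m → ℂ}
    (hu : AlgebraicIndependent ℚ u) : LinearIndependent ℚ (Fin.cons (1 : ℂ) u : Fin (m + 1) → ℂ) := by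
  classical
  rw [linearIndependent_finCons]
  refine ⟨hu.linearIndependent, fun hmem => ?_⟩
  obtain ⟨c, hc⟩ := (Submodule.mem_span_range_iff_exists_fun (R := ℚ)).mp hmem
  set P : MvPolynomial (Fin m) ℚ := ∑ i, MvPolynomial.C (c i) * MvPolynomial.X i - 1 with hP
  have hval : MvPolynomial.aeval u P = 0 := by
    simp only [hP, map_sub, map_sum, map_mul, MvPolynomial.aeval_C, MvPolynomial.aeval_X, map_one]
    rw [← hc]
    simp [Algebra.smul_def]
  have hP0 : P = 0 :=
    (algebraicIndependent_iff_injective_aeval.mp hu) (by rw [hval, map_zero])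
  have hcc : MvPolynomial.constantCoeff P = -1 := by
    simp [hP, MvPolynomial.constantCoeff_X]
  rw [hP0, map_zero] at hcc
  norm_num at hcc

/-- Scaling by `π ≠ 0` preserves ℚ-linear independence. -/
private theorem linearIndependent_pi_mul {N : ℕ} {v : Fin N → ℂ} (hv : LinearIndependent ℚ v) :
    LinearIndependent ℚ (fun i => (Real.pi : ℂ) * v i) := by
  rw [Fintype.linearIndependent_iff] at hv ⊢
  intro g hg
  apply hv g
  have hπ0 : (Real.pi : ℂ) ≠ 0 := by exact_mod_cast Real.pi_ne_zero
  have h : (Real.pi : ℂ) * ∑ i, g i • v i = 0 := by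
    rw [Finset.mul_sum]
    calc ∑ i, (Real.pi : ℂ) * (g i • v i) = ∑ i, g i • ((Real.pi : ℂ) * v i) :=
          Finset.sum_congr rfl fun i _ => by rw [mul_smul_comm]
      _ = 0 := hg
  exact (mul_eq_zero.mp h).resolve_left hπ0

/-- `(ℓ₂, ℓ₃, ρ_W)` is algebraically independent over `ℚ` — HYPOTHESIS-FREE. -/
theorem algebraicIndependent_ell2_ell3_rhoW :
    AlgebraicIndependent ℚ ![((liouvilleNumber 2 : ℝ) : ℂ), ((liouvilleNumber 3 : ℝ) : ℂ), (rhoW : ℂ)] := by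
  have h := algebraicIndependent_gapBlock two_le_b23 wt_b23_injective factorialGapLiouville_rhoW
  have e : (![((liouvilleNumber 2 : ℝ) : ℂ), ((liouvilleNumber 3 : ℝ) : ℂ), (rhoW : ℂ)] : Fin 3 → ℂ) =
      (Fin.cons (rhoW : ℂ) (fun i => ((liouvilleNumber (b23 i) : ℝ) : ℂ)) : Fin 3 → ℂ) ∘
        (![1, 2, 0] : Fin 3 → Fin 3) := by
    funext i; fin_cases i <;> simp [b23]
    rfl
  rw [e]
  exact h.comp _ (by decide)

/-- `(ℓ₂, ρ_W)` is algebraically independent over `ℚ` — HYPOTHESIS-FREE. -/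
theorem algebraicIndependent_ell2_rhoW :
    AlgebraicIndependent ℚ ![((liouvilleNumber 2 : ℝ) : ℂ), (rhoW : ℂ)] := by
  have h := algebraicIndependent_gapBlock (b := ![2]) (fun i => by fin_cases i; simp)
    (wt_injective_single (le_refl 2)) factorialGapLiouville_rhoW
  have e : (![((liouvilleNumber 2 : ℝ) : ℂ), (rhoW : ℂ)] : Fin 2 → ℂ) =
      (Fin.cons (rhoW : ℂ) (fun i => ((liouvilleNumber ((![2] : Fin 1 → ℕ) i) : ℝ) : ℂ)) : Fin 2 → ℂ) ∘
        (![1, 0] : Fin 2 → Fin 2) := by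
    funext i; fin_cases i <;> simp
  rw [e]
  exact h.comp _ (by decide)

/-- THE MEMBERS. -/
noncomputable def zG2 : Fin 2 → ℂ := ![((liouvilleNumber 2 : ℝ) : ℂ), (rhoW : ℂ)]
/-- `Fin 3 → ℂ`. -/
noncomputable def zG3 : Fin 3 → ℂ := ![(1 : ℂ), ((liouvilleNumber 2 : ℝ) : ℂ), (rhoW : ℂ)]
/-- `Fin 4 → ℂ`. -/
noncomputable def zG4 : Fin 4 → ℂ :=
  ![(1 : ℂ), ((liouvilleNumber 2 : ℝ) : ℂ), ((liouvilleNumber 3 : ℝ) : ℂ), (rhoW : ℂ)]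
/-- `Fin 3 → ℂ`. -/
noncomputable def zG3pi : Fin 3 → ℂ :=
  ![(Real.pi : ℂ), (Real.pi : ℂ) * ((liouvilleNumber 2 : ℝ) : ℂ), (Real.pi : ℂ) * (rhoW : ℂ)]
/-- `Fin 4 → ℂ`. -/
noncomputable def zG4pi : Fin 4 → ℂ :=
  ![(Real.pi : ℂ), (Real.pi : ℂ) * ((liouvilleNumber 2 : ℝ) : ℂ), (Real.pi : ℂ) * ((liouvilleNumber 3 : ℝ) : ℂ),
    (Real.pi : ℂ) * (rhoW : ℂ)]

/-- (i) ℚ-linear independence — HYPOTHESIS-FREE. -/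
theorem linearIndependent_zG2 : LinearIndependent ℚ zG2 := algebraicIndependent_ell2_rhoW.linearIndependent

/-- `LinearIndependent ℚ zG3`. -/
theorem linearIndependent_zG3 : LinearIndependent ℚ zG3 := by
  have e : zG3 = (Fin.cons (1 : ℂ) ![((liouvilleNumber 2 : ℝ) : ℂ), (rhoW : ℂ)] : Fin 3 → ℂ) := by
    funext i; fin_cases i <;> simp [zG3]
  rw [e]; exact linearIndependent_one_cons_of_algebraicIndependent algebraicIndependent_ell2_rhoW

/-- `LinearIndependent ℚ zG4`. -/
theorem linearIndependent_zG4 : LinearIndependent ℚ zG4 := by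
  have e : zG4 = (Fin.cons (1 : ℂ)
      ![((liouvilleNumber 2 : ℝ) : ℂ), ((liouvilleNumber 3 : ℝ) : ℂ), (rhoW : ℂ)] : Fin 4 → ℂ) := by
    funext i; fin_cases i <;> simp [zG4]
  rw [e]; exact linearIndependent_one_cons_of_algebraicIndependent algebraicIndependent_ell2_ell3_rhoW

/-- `LinearIndependent ℚ zG3pi`. -/
theorem linearIndependent_zG3pi : LinearIndependent ℚ zG3pi := by
  have e : zG3pi = fun i => (Real.pi : ℂ) * zG3 i := by
    funext i; fin_cases i <;> simp [zG3pi, zG3]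
  rw [e]; exact linearIndependent_pi_mul linearIndependent_zG3

/-- `LinearIndependent ℚ zG4pi`. -/
theorem linearIndependent_zG4pi : LinearIndependent ℚ zG4pi := by
  have e : zG4pi = fun i => (Real.pi : ℂ) * zG4 i := by
    funext i; fin_cases i <;> simp [zG4pi, zG4]
  rw [e]; exact linearIndependent_pi_mul linearIndependent_zG4

/-- (ii) Liouville to every polynomial order as linear forms (through the prefix `(1, ℓ₂)` / `(π, πℓ₂)`). -/
theorem linLiouville_zG3 : LinLiouville zG3 := by
  have hℓ : Liouville (liouvilleNumber 2) := liouville_liouvilleNumber (le_refl 2)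
  refine linLiouville_of_prefix (k := 2) (n := 3) (by norm_num) ?_
  have h2 : (fun i : Fin 2 => zG3 (Fin.castLE (show 2 ≤ 3 by norm_num) i)) =
      ![(1 : ℂ), ((liouvilleNumber 2 : ℝ) : ℂ) * 1] := by
    funext i; fin_cases i <;> simp [zG3]
  rw [h2]
  exact linLiouville_of_liouville_ratio hℓ 1

/-- `LinLiouville zG4`. -/
theorem linLiouville_zG4 : LinLiouville zG4 := by
  have hℓ : Liouville (liouvilleNumber 2) := liouville_liouvilleNumber (le_refl 2)
  refine linLiouville_of_prefix (k := 2) (n := 4) (by norm_num) ?_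
  have h2 : (fun i : Fin 2 => zG4 (Fin.castLE (show 2 ≤ 4 by norm_num) i)) =
      ![(1 : ℂ), ((liouvilleNumber 2 : ℝ) : ℂ) * 1] := by
    funext i; fin_cases i <;> simp [zG4]
  rw [h2]
  exact linLiouville_of_liouville_ratio hℓ 1

/-- `LinLiouville zG3pi`. -/
theorem linLiouville_zG3pi : LinLiouville zG3pi := by
  have hℓ : Liouville (liouvilleNumber 2) := liouville_liouvilleNumber (le_refl 2)
  refine linLiouville_of_prefix (k := 2) (n := 3) (by norm_num) ?_
  have h2 : (fun i : Fin 2 => zG3pi (Fin.castLE (show 2 ≤ 3 by norm_num) i)) =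
      ![(Real.pi : ℂ), ((liouvilleNumber 2 : ℝ) : ℂ) * (Real.pi : ℂ)] := by
    funext i; fin_cases i <;> simp [zG3pi, mul_comm]
  rw [h2]
  exact linLiouville_of_liouville_ratio hℓ (Real.pi : ℂ)

/-- `LinLiouville zG4pi`. -/
theorem linLiouville_zG4pi : LinLiouville zG4pi := by
  have hℓ : Liouville (liouvilleNumber 2) := liouville_liouvilleNumber (le_refl 2)
  refine linLiouville_of_prefix (k := 2) (n := 4) (by norm_num) ?_
  have h2 : (fun i : Fin 2 => zG4pi (Fin.castLE (show 2 ≤ 4 by norm_num) i)) =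
      ![(Real.pi : ℂ), ((liouvilleNumber 2 : ℝ) : ℂ) * (Real.pi : ℂ)] := by
    funext i; fin_cases i <;> simp [zG4pi, mul_comm]
  rw [h2]
  exact linLiouville_of_liouville_ratio hℓ (Real.pi : ℂ)

/-- (iii) the scope of 31077: a span element with a Liouville coordinate — here TWO distinct kinds: `ℓ₂` (expansion)
and `ρ_W` (gap-Liouville, hence Liouville: `liouville_rhoW`). -/
theorem coordLiouvilleSpan_zG2 : ∃ w ∈ Submodule.span ℚ (Set.range zG2), Liouville w.re ∨ Liouville w.im :=
  ⟨zG2 1, Submodule.subset_span ⟨1, rfl⟩, Or.inl (by simpa [zG2] using liouville_rhoW)⟩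

/-- `∃ w ∈ Submodule.span ℚ (Set.range zG3), Liouville w.re ∨ Liouville w.im`. -/
theorem coordLiouvilleSpan_zG3 : ∃ w ∈ Submodule.span ℚ (Set.range zG3), Liouville w.re ∨ Liouville w.im :=
  ⟨zG3 2, Submodule.subset_span ⟨2, rfl⟩, Or.inl (by simpa [zG3] using liouville_rhoW)⟩

/-- `∃ w ∈ Submodule.span ℚ (Set.range zG4), Liouville w.re ∨ Liouville w.im`. -/
theorem coordLiouvilleSpan_zG4 : ∃ w ∈ Submodule.span ℚ (Set.range zG4), Liouville w.re ∨ Liouville w.im :=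
  ⟨zG4 3, Submodule.subset_span ⟨3, rfl⟩, Or.inl (by simpa [zG4] using liouville_rhoW)⟩

/-- (iv) Schanuel's bound AT THE MEMBERS: `(ℓ₂, ρ_W)` and the π-twins HYPOTHESIS-FREE, the e-walls mod `hNW`. -/
theorem sb_zG2 : SB 2 zG2 := sb_gapPair (le_refl 2) factorialGapLiouville_rhoW
/-- `SB 3 zG3`. -/
theorem sb_zG3 (hNW : NWMeasure) : SB 3 zG3 := sb_gapWall3 hNW (le_refl 2) factorialGapLiouville_rhoW
/-- `SB 4 zG4`. -/
theorem sb_zG4 (hNW : NWMeasure) : SB 4 zG4 := sb_gapWall4 hNW factorialGapLiouville_rhoW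
/-- `SB 3 zG3pi`. -/
theorem sb_zG3pi : SB 3 zG3pi := sb_gapWall3_pi (le_refl 2) factorialGapLiouville_rhoW
/-- `SB 4 zG4pi`. -/
theorem sb_zG4pi : SB 4 zG4pi := sb_gapWall4_pi factorialGapLiouville_rhoW

/-- (v) THE LIVE ITEM 31077 APPLIED at the members (its text as a hypothesis, binders verbatim). -/
theorem item31077_at_zG4
    (h31077 : ∀ (n : ℕ) (z : Fin n → ℂ), LinearIndependent ℚ z →
      (∃ w ∈ Submodule.span ℚ (Set.range z), Liouville w.re ∨ Liouville w.im) →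
      (n : Cardinal) ≤ Algebra.trdeg ℚ
        ↥(IntermediateField.adjoin ℚ (Set.range z ∪ Set.range (Complex.exp ∘ z)))) :
    SB 4 zG4 := h31077 4 zG4 linearIndependent_zG4 coordLiouvilleSpan_zG4

/-- `SB 2 zG2`. -/
theorem item31077_at_zG2
    (h31077 : ∀ (n : ℕ) (z : Fin n → ℂ), LinearIndependent ℚ z →
      (∃ w ∈ Submodule.span ℚ (Set.range z), Liouville w.re ∨ Liouville w.im) →
      (n : Cardinal) ≤ Algebra.trdeg ℚ
        ↥(IntermediateField.adjoin ℚ (Set.range z ∪ Set.range (Complex.exp ∘ z)))) :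
    SB 2 zG2 := h31077 2 zG2 linearIndependent_zG2 coordLiouvilleSpan_zG2

end Certificates

end Summit.Schanuel.Schanuel.Theorems.RootDecomp1KGapCell
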